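/-
Origin: expansion seat `planner-pub-hodgecm-pohl-g9-0`, handover #4 v3 2026-08-18T09:24:24Z (`HOME/pub-hodgecm-pohl-g9/lean/Pohl9/AnyCMFieldNoN4.lean`, md5 98cc61b6, 366 lines);
landed by the gen-7 packager in gate run 27 as `HodgeCM/Proofs/Pohlmann/AnyCMFieldNoN4.lean` (import ^import Toy2g5\.PohlmannNoN4\b→import HodgeCM.Proofs.Pohlmann.PohlmannNoN4 ×1).
-/
/-
Copyright: pub-hodgecm formalisation cell (harness21, 2026). New file (not vendored).
Origin: HOME/pub-hodgecm-pohl-g9/lean/Pohl9/AnyCMFieldNoN4.lean — session planner-pub-hodgecm-pohl-g9-0 (unit pub-hodgecm-pohl-g9),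
EXPANSION part (b) `PohlmannSpan`, generation 9, fourth file.  Intended final place:
`HodgeCM/Proofs/Pohlmann/AnyCMFieldNoN4.lean` (module `HodgeCM.Proofs.Pohlmann.AnyCMFieldNoN4`).  ADDITIVE leaf: imports the
landed `HodgeCM.Proofs.Pohlmann.AnyCMField` (gate run 26) and toy2-g5's `PohlmannNoN4` (handed for run 27 as
`HodgeCM.Proofs.Pohlmann.PohlmannNoN4`; imported below under its WIP name `Toy2g5.PohlmannNoN4`, ONE import line to be rewritten
at landing); replaces nothing; nothing imports it.  Must land AFTER `PohlmannNoN4`.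
-/
import Summits.HodgeConjecture.HodgeCM.Proofs.Pohlmann.AnyCMField
import Summits.HodgeConjecture.HodgeCM.Proofs.Pohlmann.PohlmannNoN4

/-!
# Pohlmann's span theorem for ANY CM field from `ModelAxioms` + N1 + N2 + N3 — no `IsGalois ℚ F`, no N4

Two independent improvements of the landed `pohlmannSpan_of_facts (M) (hN1) (hN2) (hN3) (hN4) : U.PohlmannSpan`
(WeightHodge.lean, run 20) compose:

* `AnyCMField.lean` (this lineage, run 26) removes the hypothesis `IsGalois ℚ F` by indexing the weight vectors with the
  source's condition (3.2) for `G = Gal(E^c/ℚ)` (`IsHodgeWeightC`; Gao–Ullmo Thm 3.1 "(Pohlmann)",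
  `GaoUllmo.isHodgeWeightC_iff_satisfiesEq32`): `pohlmannSpanCM_of_facts (M) (hN1) (hN2) (hN3) (hN4) : U.PohlmannSpanCM`;
* `PohlmannNoN4.lean` (toy2-g5, run 27) removes N4 `Fact_hodge_F0`: M30 is consumed only in degree `2p`
  (`Fact_weightHodgeAt (2 * p)`, a theorem of `ModelAxioms` + N1 + N2 for `2p ≥ 2`: `weightHodgeAt_of_facts_of_pos`), and level
  `0` needs N3 only (the empty weight).

This file proves the common refinement

  `pohlmannSpanCM_of_facts₃ (M : U.ModelAxioms) (hN1 : U.Fact_cupExterior) (hN2 : U.Fact_cup_hodge) (hN3 : U.Fact_pull_H0) :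
     U.PohlmannSpanCM`

— the span inclusion `B^p(A′) ⊗ 1 ⊆ span_ℂ {weight vectors of (3.2)-Hodge weights}` for EVERY CM field `F`, every family of
CM types `Θ` and every `p`, from the model axioms and the three textbook facts N1–N3 — and records that the landed proofs are
literally its specialisations (`pohlmannSpanCM_of_facts_eq₃`, `pohlmannSpan_of_facts₃_eq`, both `rfl`).

Scope note (for the input tables): N4 remains load-bearing for the BASIS / EQUALITY forms at level `0` (`PohlmannBasisCM`,
`PohlmannTheorem31AllCM`, and their Galois versions: `B⁰ ⊗ ℂ = V_∅ = H⁰(A′, ℂ)` says every rational class of `H⁰` is Hodge);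
only the SPAN statements drop it, and N4 enters ONLY at level `0`: for `p ≥ 1` the equality
`B^p ⊗ ℂ = ⨆_{S : IsHodgeWeightC} V_S` holds from `ModelAxioms` + N1 + N2 + N3 (`baseChange_hodgeClassesOf_eq_iSupC_of_pos`,
via the localised `⊇` `weightSpace_le_baseChange_hodgeClassesOf_C_of_weightHodgeAt`), and so do both sentences of Thm 3.1 at
`p ≥ 1` — basis and `dim_ℚ B^p(A′) = #{S : IsHodgeWeightC Θ p S}` — `pohlmannTheorem31CM_of_facts₃ (M) (hN1) (hN2) (hN3) :
U.PohlmannTheorem31CM` (and the Galois `PohlmannTheorem31`: `pohlmannTheorem31_of_facts₃`).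
-/

noncomputable section

open scoped TensorProduct NumberField BigOperators
open Polynomial

namespace HodgeCM

open Literature.AlgebraicGeometry.Motives (CMType HodgeStructure)
open Literature.AlgebraicGeometry.Motives.HodgeStructure (ofRat ofRat_apply)
open HodgeCM.Pohlmann HodgeCM.GaoUllmo HodgeCM.CMTypeOps

attribute [local instance] Classical.propDecidable

namespace Universe

variable {U : Universe}

/-! ### `⊆` at level `p` with M30 in degree `2p` only, any CM field -/

section AnyF

variable {F : CMField} {n : ℕ} {Θ : Fin (n + 1) → CMType F} {ι : Type} [Fintype ι]
  {j : ι → Fin (n + 1)} {a : ι → 𝓞 F} {c : ι → ℕ} {Mi : ι → U.Mor (U.cmProd F Θ) (U.cmProd F Θ)}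

/-- Every weight met by the complexified Hodge classes of level `p` is a Galois-closure Hodge weight — any CM field `F`,
M30 in degree `2p` only (the proof of `isHodgeWeightC_of_meets` with `types_of_meetsAt` for `types_of_meets`). -/
theorem isHodgeWeightC_of_meetsAt (M : U.ModelAxioms) (h29 : U.Fact_weightSpan) (p : ℕ)
    (h30 : U.Fact_weightHodgeAt (2 * p))
    (hM : ∀ i, U.IsFactorAct F Θ (j i) (a i : F) (Mi i)) (hinj : Function.Injective (sepVal j a c))
    {S : Fin (n + 1) → Finset ((F : Type) →+* ℂ)}
    (hS : (U.hodgeClassesOf (U.cmProd F Θ) p).baseChange ℂ ⊓ U.weightSpace F Θ S (2 * p) ≠ ⊥) :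
    IsHodgeWeightC Θ p S := by
  refine ⟨?_, fun σ => ?_⟩
  · obtain ⟨hp, hq⟩ := types_of_meetsAt p h30 hS
    have hsum : (∑ j, ∑ s ∈ S j, ind (Θ j) s) + (∑ j, ∑ s ∈ S j, (1 - ind (Θ j) s)) =
        ((∑ j, (S j).card : ℕ) : ℤ) := by
      rw [← Finset.sum_add_distrib, Nat.cast_sum]
      refine Finset.sum_congr rfl fun j _ => ?_
      rw [← Finset.sum_add_distrib, Finset.sum_congr rfl fun s _ => add_sub_cancel (ind (Θ j) s) 1]
      simp
    rw [hp, hq] at hsum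
    have : ((∑ j, (S j).card : ℕ) : ℤ) = ((2 * p : ℕ) : ℤ) := by rw [← hsum]; push_cast; ring
    exact_mod_cast this
  · have h := (types_of_meetsAt p h30 (meets_permWeight_galTOf M h29 hM hinj p hS σ)).1
    rw [sum_sum_permWeight (galTOf σ).1 S fun j t => ind (Θ j) t] at h
    simpa only [galTOf_apply] using h

/-- `B^p ⊗ ℂ ≤ ⨆_{S : IsHodgeWeightC} V_S` with a chosen separating family, any CM field, M30 in degree `2p` only. -/
theorem baseChange_hodgeClassesOf_le_iSupC_of_weightHodgeAt (M : U.ModelAxioms) (h29 : U.Fact_weightSpan) (p : ℕ)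
    (h30 : U.Fact_weightHodgeAt (2 * p))
    (hM : ∀ i, U.IsFactorAct F Θ (j i) (a i : F) (Mi i)) (hinj : Function.Injective (sepVal j a c)) :
    (U.hodgeClassesOf (U.cmProd F Θ) p).baseChange ℂ ≤
      ⨆ (S : Fin (n + 1) → Finset ((F : Type) →+* ℂ)) (_ : IsHodgeWeightC Θ p S), U.weightSpace F Θ S (2 * p) :=
  (baseChange_hodgeClassesOf_le M h29 hM hinj p).trans
    (iSup₂_le fun S hS => le_iSup₂_of_le S (isHodgeWeightC_of_meetsAt M h29 p h30 hM hinj hS) le_rfl)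

/-- The weight space of a Galois-closure Hodge weight lies in `H^{p,p}` — M30 in degree `2p` only. -/
theorem weightSpace_le_piece_of_isHodgeWeightC_of_weightHodgeAt {p : ℕ} (h30 : U.Fact_weightHodgeAt (2 * p))
    {S : Fin (n + 1) → Finset ((F : Type) →+* ℂ)} (hS : IsHodgeWeightC Θ p S) :
    U.weightSpace F Θ S (2 * p) ≤ (U.hodge (U.cmProd F Θ) (2 * p)).piece p p := by
  have h := h30 F n Θ S
  obtain ⟨hp, hq⟩ := types_of_isHodgeWeightC hS
  rwa [hp, hq] at h

/-- **`⊇` for any CM field `F`, M30 in degree `2p` only**: the weight space of a Galois-closure Hodge weight lies in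
`B^p(A′) ⊗ ℂ` (the proof of `weightSpace_le_baseChange_hodgeClassesOf_C`, AnyCMField.lean, verbatim with the localised hypothesis;
Gao–Ullmo, proof of Thm 3.1, p0009 L46–L47). -/
theorem weightSpace_le_baseChange_hodgeClassesOf_C_of_weightHodgeAt (h29 : U.Fact_weightSpan) {p : ℕ}
    (h30 : U.Fact_weightHodgeAt (2 * p))
    (hM : ∀ i, U.IsFactorAct F Θ (j i) (a i : F) (Mi i))
    (hinj : Function.Injective (sepVal j a c)) {S : Fin (n + 1) → Finset ((F : Type) →+* ℂ)}
    (hS : IsHodgeWeightC Θ p S) :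
    U.weightSpace F Θ S (2 * p) ≤ (U.hodgeClassesOf (U.cmProd F Θ) p).baseChange ℂ := by
  classical
  -- `λ(S) = y ∈ E^c`, `χ = minpoly y`, `Q = χ(T)`
  obtain ⟨y, hy, -, hPy⟩ := exists_sepVal_eq_closure j a c S
  set T : U.Coh (U.cmProd F Θ) (2 * p) →ₗ[ℚ] U.Coh (U.cmProd F Θ) (2 * p) := U.sepOp c Mi (2 * p) with hT
  set χ : ℚ[X] := minpoly ℚ y with hχ
  set Q : U.Coh (U.cmProd F Θ) (2 * p) →ₗ[ℚ] U.Coh (U.cmProd F Θ) (2 * p) := aeval T χ with hQ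
  have hQC : Q.baseChange ℂ = aeval (T.baseChange ℂ) (χ.map (algebraMap ℚ ℂ)) :=
    baseChange_aeval_map T χ
  -- `ker Q_ℂ` is `T_ℂ`-stable
  set K' : Submodule ℂ (U.CohC (U.cmProd F Θ) (2 * p)) := LinearMap.ker (Q.baseChange ℂ) with hK'
  have hcomm : Commute (T.baseChange ℂ) (Q.baseChange ℂ) := by
    have h := (commute_X (χ.map (algebraMap ℚ ℂ))).map (aeval (T.baseChange ℂ))
    rwa [aeval_X, ← hQC] at h
  have hK'stab : ∀ z ∈ K', T.baseChange ℂ z ∈ K' := by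
    intro z hz
    rw [hK', LinearMap.mem_ker] at hz ⊢
    rw [← Module.End.mul_apply, ← hcomm.eq, Module.End.mul_apply, hz, map_zero]
  -- `ker Q_ℂ ⊆ H^{p,p}`
  have hK'le : K' ≤ (U.hodge (U.cmProd F Θ) (2 * p)).piece p p := by
    have hdec : K' = ⨆ μ, K' ⊓ Module.End.eigenspace (T.baseChange ℂ) μ := by
      have h := Submodule.inf_iSup_genEigenspace (p := K') (f := T.baseChange ℂ) hK'stab 1
      rw [iSup_eigenspace_eq_top h29 hM (2 * p), inf_top_eq] at h
      exact h
    refine hdec.le.trans (iSup_le fun μ => ?_)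
    by_cases hμ : K' ⊓ Module.End.eigenspace (T.baseChange ℂ) μ = ⊥
    · rw [hμ]; exact bot_le
    obtain ⟨z, hz, hz0⟩ := (Submodule.ne_bot_iff _).mp hμ
    obtain ⟨hzK, hzE⟩ := Submodule.mem_inf.mp hz
    -- `μ` is a root of `χ_ℂ`
    have hroot : (χ.map (algebraMap ℚ ℂ)).eval μ = 0 := by
      have h1 : Q.baseChange ℂ z = 0 := hzK
      rw [hQC, aeval_apply_of_mem_eigenspace hzE] at h1
      exact (smul_eq_zero.mp h1).resolve_right hz0
    -- `μ = λ(S')`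
    have hE : Module.End.eigenspace (T.baseChange ℂ) μ ≠ ⊥ :=
      fun h => hμ (eq_bot_iff.mpr (inf_le_right.trans h.le))
    obtain ⟨S', hS'⟩ := exists_sepVal_eq h29 hM (2 * p) hE
    -- NEW STEP: a complex root of `minpoly_ℚ(y)`, `y ∈ E^c`, is `ψ y` for an embedding `ψ : E^c → ℂ`
    have hmem : μ ∈ (minpoly ℚ y).rootSet ℂ := by
      rw [mem_rootSet]
      refine ⟨minpoly.ne_zero (IsIntegral.of_finite ℚ y), ?_⟩
      rw [aeval_def, ← eval_map]
      exact hroot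
    rw [← Algebra.IsAlgebraic.range_eval_eq_rootSet_minpoly] at hmem
    obtain ⟨ψ, hψ⟩ := hmem
    -- the element `σ_ψ ∈ Gal(E^c/ℚ)` carries `S` to `S'`
    have hSS' : permWeight (galTOf (autOfEmb ψ)).1 S = S' := by
      apply hinj
      rw [hPy ψ, hS']
      exact hψ
    -- conclude with M30 for the Galois-closure Hodge weight `S' = σ_ψ • S`
    calc K' ⊓ Module.End.eigenspace (T.baseChange ℂ) μ
        ≤ Module.End.eigenspace (T.baseChange ℂ) μ := inf_le_right
      _ = U.weightSpace F Θ S' (2 * p) := by rw [← hS', eigenspace_eq_weightSpace h29 hM hinj (2 * p) S']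
      _ ≤ (U.hodge (U.cmProd F Θ) (2 * p)).piece p p :=
          weightSpace_le_piece_of_isHodgeWeightC_of_weightHodgeAt h30 (hSS' ▸ isHodgeWeightC_permWeight hS _)
  -- (1) the RATIONAL subspace `ker Q` consists of Hodge classes
  have hK : LinearMap.ker Q ≤ U.hodgeClassesOf (U.cmProd F Θ) p := by
    intro v hv
    have hvC : ofRat v ∈ K' := by
      rw [hK', LinearMap.mem_ker, ofRat_apply, LinearMap.baseChange_tmul, LinearMap.mem_ker.mp hv,
        TensorProduct.tmul_zero]
    change ofRat v ∈ (U.hodge (U.cmProd F Θ) (2 * p)).F p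
    exact HodgeStructure.piece_le_F _ _ _ (hK'le hvC)
  -- (2) `V_S ⊆ ker Q_ℂ = (ker Q) ⊗ ℂ ⊆ B ⊗ ℂ`
  have hχy : (χ.map (algebraMap ℚ ℂ)).eval (y : ℂ) = 0 := by
    have h : ((y : galoisClosure (Fin (n + 1) → (F : Type))) : ℂ) =
        algebraMap (galoisClosure (Fin (n + 1) → (F : Type))) ℂ y := rfl
    rw [eval_map, ← aeval_def, h, aeval_algebraMap_apply, hχ, minpoly.aeval, map_zero]
  intro x hx
  have hxK : x ∈ LinearMap.ker (Q.baseChange ℂ) := by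
    rw [LinearMap.mem_ker, hQC, aeval_apply_of_mem_eigenspace (weightSpace_le_eigenspace hM (2 * p) S hx),
      hy, hχy, zero_smul]
  rw [ker_baseChange_eq] at hxK
  exact Submodule.baseChange_mono ℂ hK hxK

/-- **Pohlmann's theorem (equality form) with a chosen separating family, any CM field, M29 + M30 in degree `2p` only.** -/
theorem baseChange_hodgeClassesOf_eq_iSupC_of_weightHodgeAt (M : U.ModelAxioms) (h29 : U.Fact_weightSpan) (p : ℕ)
    (h30 : U.Fact_weightHodgeAt (2 * p))
    (hM : ∀ i, U.IsFactorAct F Θ (j i) (a i : F) (Mi i)) (hinj : Function.Injective (sepVal j a c)) :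
    (U.hodgeClassesOf (U.cmProd F Θ) p).baseChange ℂ =
      ⨆ (S : Fin (n + 1) → Finset ((F : Type) →+* ℂ)) (_ : IsHodgeWeightC Θ p S), U.weightSpace F Θ S (2 * p) :=
  le_antisymm (baseChange_hodgeClassesOf_le_iSupC_of_weightHodgeAt M h29 p h30 hM hinj)
    (iSup₂_le fun _ hS => weightSpace_le_baseChange_hodgeClassesOf_C_of_weightHodgeAt h29 h30 hM hinj hS)

end AnyF

/-! ### The span inclusion at one level, any CM field -/

section Print

variable {F : CMField} {n : ℕ} {Θ : Fin (n + 1) → CMType F}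

/-- **Pohlmann's span inclusion at level `p`, any CM field `F`, from M1–M28, M29 and M30 IN DEGREE `2p`.** -/
theorem pohlmannSpanCMAt_of_weightHodgeAt (M : U.ModelAxioms) (h29 : U.Fact_weightSpan) (p : ℕ)
    (h30 : U.Fact_weightHodgeAt (2 * p)) (F : CMField) (n : ℕ) (Θ : Fin (n + 1) → CMType F) :
    (U.hodgeClassesOf (U.cmProd F Θ) p).map ofRat ≤
      (Submodule.span ℂ {x : U.CohC (U.cmProd F Θ) (2 * p) |
          ∃ S : Fin (n + 1) → Finset ((F : Type) →+* ℂ),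
            IsHodgeWeightC Θ p S ∧ U.IsWeightVector F Θ S (2 * p) x}).restrictScalars ℚ := by
  obtain ⟨j, a, c, hinj⟩ := exists_separating_family (F := (F : Type)) n
  choose Mi hMi using fun i => exists_isFactorAct M F Θ (j i) (a i)
  have hinj' : Function.Injective (sepVal j a c) := hinj
  rw [Submodule.map_le_iff_le_comap]
  intro b hb
  rw [Submodule.mem_comap, Submodule.restrictScalars_mem]
  have hbC : ofRat b ∈ (U.hodgeClassesOf (U.cmProd F Θ) p).baseChange ℂ :=
    Submodule.tmul_mem_baseChange_of_mem 1 hb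
  refine (baseChange_hodgeClassesOf_le_iSupC_of_weightHodgeAt M h29 p h30 hMi hinj').trans ?_ hbC
  exact iSup₂_le fun S hS x hx => Submodule.subset_span ⟨S, hS, (U.mem_weightSpace_iff F Θ S (2 * p) x).1 hx⟩

/-- **At level `0` the span inclusion needs N3 only, any CM field**: the empty weight satisfies (3.2) for `p = 0`, and under
N3 every class of `H⁰(A′, ℂ)` is a weight vector of the empty weight (compare `pohlmannSpanAt_zero_of_pull_H0`). -/
theorem pohlmannSpanCMAt_zero_of_pull_H0 (hN3 : U.Fact_pull_H0) (F : CMField) (n : ℕ) (Θ : Fin (n + 1) → CMType F) :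
    (U.hodgeClassesOf (U.cmProd F Θ) 0).map ofRat ≤
      (Submodule.span ℂ {x : U.CohC (U.cmProd F Θ) (2 * 0) |
          ∃ S : Fin (n + 1) → Finset ((F : Type) →+* ℂ),
            IsHodgeWeightC Θ 0 S ∧ U.IsWeightVector F Θ S (2 * 0) x}).restrictScalars ℚ := by
  rintro y -
  rw [Submodule.restrictScalars_mem]
  refine Submodule.subset_span ⟨fun _ => ∅, ⟨by simp, fun σ => by simp⟩, fun j a Ma _ => ?_⟩
  rw [Finset.prod_empty, one_smul]
  have h : U.pull Ma (2 * 0) = LinearMap.id := hN3 _ Ma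
  show (U.pull Ma (2 * 0)).baseChange ℂ y = y
  rw [h, LinearMap.baseChange_id]
  rfl

/-- At levels `p ≥ 1` the inclusion `B^p ⊗ ℂ ≤ ⨆_{S : IsHodgeWeightC} V_S` holds from `ModelAxioms` + N1 + N2 + N3
(M29 + M30 in degree `2p ≥ 2`), any CM field. -/
theorem baseChange_hodgeClassesOf_le_iSupC_of_pos (M : U.ModelAxioms) (hN1 : U.Fact_cupExterior)
    (hN2 : U.Fact_cup_hodge) (hN3 : U.Fact_pull_H0) {p : ℕ} (hp : 0 < p) :
    (U.hodgeClassesOf (U.cmProd F Θ) p).baseChange ℂ ≤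
      ⨆ (S : Fin (n + 1) → Finset ((F : Type) →+* ℂ)) (_ : IsHodgeWeightC Θ p S), U.weightSpace F Θ S (2 * p) := by
  obtain ⟨j, a, c, hinj⟩ := exists_separating_family (F := (F : Type)) n
  choose Mi hMi using fun i => exists_isFactorAct M F Θ (j i) (a i)
  have hinj' : Function.Injective (sepVal j a c) := hinj
  exact baseChange_hodgeClassesOf_le_iSupC_of_weightHodgeAt M (weightSpan_of_facts M hN1 hN3) p
    (weightHodgeAt_of_facts_of_pos M hN1 hN2 (by omega)) hMi hinj'


/-- **N4 enters Pohlmann's theorem only at level `0`**: for `p ≥ 1` the EQUALITY `B^p ⊗ ℂ = ⨆_{S : IsHodgeWeightC} V_S`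
(`PohlmannBasisCM` at level `p`) holds from `ModelAxioms` + N1 + N2 + N3, any CM field. -/
theorem baseChange_hodgeClassesOf_eq_iSupC_of_pos (M : U.ModelAxioms) (hN1 : U.Fact_cupExterior)
    (hN2 : U.Fact_cup_hodge) (hN3 : U.Fact_pull_H0) {p : ℕ} (hp : 0 < p) :
    (U.hodgeClassesOf (U.cmProd F Θ) p).baseChange ℂ =
      ⨆ (S : Fin (n + 1) → Finset ((F : Type) →+* ℂ)) (_ : IsHodgeWeightC Θ p S), U.weightSpace F Θ S (2 * p) := by
  obtain ⟨j, a, c, hinj⟩ := exists_separating_family (F := (F : Type)) n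
  choose Mi hMi using fun i => exists_isFactorAct M F Θ (j i) (a i)
  have hinj' : Function.Injective (sepVal j a c) := hinj
  exact baseChange_hodgeClassesOf_eq_iSupC_of_weightHodgeAt M (weightSpan_of_facts M hN1 hN3) p
    (weightHodgeAt_of_facts_of_pos M hN1 hN2 (by omega)) hMi hinj'

end Print


/-! ### Basis and dimension at levels `p ≥ 1` from N1–N3, any CM field -/

section Lines

variable {F : CMField} {n : ℕ} {Θ : Fin (n + 1) → CMType F}

/-- The basis of `B^p(A′) ⊗ ℂ` indexed by the Galois-closure Hodge weights, GIVEN the equality `B^p ⊗ ℂ = ⨆ V_S` and that each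
`V_S` is a line (the proof of `exists_basis_hodgeClassesOf_C_of_lines`, AnyCMField.lean, with the equality as a hypothesis). -/
theorem exists_basis_hodgeClassesOf_C_of_eq (M : U.ModelAxioms) (p : ℕ)
    (heq : (U.hodgeClassesOf (U.cmProd F Θ) p).baseChange ℂ =
      ⨆ (S : Fin (n + 1) → Finset ((F : Type) →+* ℂ)) (_ : IsHodgeWeightC Θ p S), U.weightSpace F Θ S (2 * p))
    (hl : ∀ S : Fin (n + 1) → Finset ((F : Type) →+* ℂ), IsHodgeWeightC Θ p S →
      Module.finrank ℂ (U.weightSpace F Θ S (2 * p)) = 1) :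
    ∃ b : Module.Basis {S : Fin (n + 1) → Finset ((F : Type) →+* ℂ) // IsHodgeWeightC Θ p S} ℂ
        ↥((U.hodgeClassesOf (U.cmProd F Θ) p).baseChange ℂ),
      ∀ S, ((b S : ↥((U.hodgeClassesOf (U.cmProd F Θ) p).baseChange ℂ)) : U.CohC (U.cmProd F Θ) (2 * p)) ∈
        U.weightSpace F Θ S.1 (2 * p) := by
  classical
  have h1 : ∀ S : {S : Fin (n + 1) → Finset ((F : Type) →+* ℂ) // IsHodgeWeightC Θ p S},
      Module.finrank ℂ (U.weightSpace F Θ S.1 (2 * p)) = 1 := fun S => hl S.1 S.2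
  have hne : ∀ S : {S : Fin (n + 1) → Finset ((F : Type) →+* ℂ) // IsHodgeWeightC Θ p S},
      ∃ v ∈ U.weightSpace F Θ S.1 (2 * p), v ≠ 0 := fun S => by
    apply Submodule.exists_mem_ne_zero_of_ne_bot
    intro h
    have h' := h1 S
    rw [h, finrank_bot] at h'
    exact zero_ne_one h'
  choose v hv hv0 using hne
  have hli : LinearIndependent ℂ v :=
    iSupIndep.linearIndependent _ (iSupIndep_weightSpace_hodgeC M p) hv hv0
  have hline : ∀ S, U.weightSpace F Θ S.1 (2 * p) = ℂ ∙ v S := fun S =>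
    (Submodule.eq_of_le_of_finrank_le ((Submodule.span_singleton_le_iff_mem _ _).mpr (hv S))
      (by rw [h1 S, finrank_span_singleton (hv0 S)])).symm
  have hspan : Submodule.span ℂ (Set.range v) = (U.hodgeClassesOf (U.cmProd F Θ) p).baseChange ℂ := by
    rw [heq, iSup_subtype', Submodule.span_range_eq_iSup]
    exact iSup_congr fun S => (hline S).symm
  refine ⟨(Module.Basis.span hli).map (LinearEquiv.ofEq _ _ hspan), fun S => ?_⟩
  rw [Module.Basis.map_apply, LinearEquiv.coe_ofEq_apply, Module.Basis.span_apply]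
  exact hv S

/-- **Gao–Ullmo Thm 3.1 "(Pohlmann)", both sentences (basis + `dim_ℚ B^p = #` Galois-closure Hodge weights), `p ≥ 1`, ANY CM
field, from `ModelAxioms` + N1 + N2 + N3 — without N4** (`PohlmannTheorem31CM` of AnyCMField.lean). -/
theorem pohlmannTheorem31CM_of_facts₃ (M : U.ModelAxioms) (hN1 : U.Fact_cupExterior) (hN2 : U.Fact_cup_hodge)
    (hN3 : U.Fact_pull_H0) : U.PohlmannTheorem31CM := fun F n Θ p hp => by
  have hl : ∀ S : Fin (n + 1) → Finset ((F : Type) →+* ℂ), IsHodgeWeightC Θ p S →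
      Module.finrank ℂ (U.weightSpace F Θ S (2 * p)) = 1 := fun S hS => by
    rw [finrank_weightSpace M hN1 (by omega) S, if_pos hS.1]
  obtain ⟨b, hb⟩ := exists_basis_hodgeClassesOf_C_of_eq (F := F) (n := n) (Θ := Θ) M p
    (baseChange_hodgeClassesOf_eq_iSupC_of_pos M hN1 hN2 hN3 hp) hl
  refine ⟨⟨b, hb⟩, ?_⟩
  rw [← Module.finrank_eq_nat_card_basis b,
    ← (Submodule.toBaseChange.toLinearEquiv ℂ (U.hodgeClassesOf (U.cmProd F Θ) p)).finrank_eq,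
    Module.finrank_baseChange]

/-- … hence the Galois statement `PohlmannTheorem31` (PohlmannTheorem.lean) from `ModelAxioms` + N1 + N2 + N3. -/
theorem pohlmannTheorem31_of_facts₃ (M : U.ModelAxioms) (hN1 : U.Fact_cupExterior) (hN2 : U.Fact_cup_hodge)
    (hN3 : U.Fact_pull_H0) : U.PohlmannTheorem31 :=
  pohlmannTheorem31_of_pohlmannTheorem31CM (pohlmannTheorem31CM_of_facts₃ M hN1 hN2 hN3)

end Lines

/-! ### The theorem -/

/-- **Pohlmann's span theorem for an ARBITRARY CM field from `ModelAxioms` + N1 + N2 + N3 — without `IsGalois ℚ F` and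
without N4 `Fact_hodge_F0`.**  Level `0`: `pohlmannSpanCMAt_zero_of_pull_H0`; level `p ≥ 1`: M29 = `weightSpan_of_facts M hN1 hN3`,
M30 in degree `2p ≥ 2` = `weightHodgeAt_of_facts_of_pos M hN1 hN2`. -/
theorem pohlmannSpanCM_of_facts₃ (M : U.ModelAxioms) (hN1 : U.Fact_cupExterior) (hN2 : U.Fact_cup_hodge)
    (hN3 : U.Fact_pull_H0) : U.PohlmannSpanCM := by
  intro F n Θ p
  cases p with
  | zero => exact pohlmannSpanCMAt_zero_of_pull_H0 hN3 F n Θ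
  | succ q =>
    exact pohlmannSpanCMAt_of_weightHodgeAt M (weightSpan_of_facts M hN1 hN3) (q + 1)
      (weightHodgeAt_of_facts_of_pos M hN1 hN2 (by omega)) F n Θ

/-- … hence `PohlmannSpan` (the package statement, Galois `F`) from `ModelAxioms` + N1 + N2 + N3 through the any-CM-field
route; this is toy2-g5's `pohlmannSpan_of_facts₃` up to proof irrelevance (`pohlmannSpan_of_facts₃_eq`). -/
theorem pohlmannSpan_of_facts₃' (M : U.ModelAxioms) (hN1 : U.Fact_cupExterior) (hN2 : U.Fact_cup_hodge)
    (hN3 : U.Fact_pull_H0) : U.PohlmannSpan :=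
  pohlmannSpan_of_pohlmannSpanCM (pohlmannSpanCM_of_facts₃ M hN1 hN2 hN3)

/-- The run-26 theorem `pohlmannSpanCM_of_facts` is the special case with the redundant hypothesis N4. -/
theorem pohlmannSpanCM_of_facts_eq₃ (M : U.ModelAxioms) (hN1 : U.Fact_cupExterior) (hN2 : U.Fact_cup_hodge)
    (hN3 : U.Fact_pull_H0) (hN4 : U.Fact_hodge_F0) :
    pohlmannSpanCM_of_facts M hN1 hN2 hN3 hN4 = pohlmannSpanCM_of_facts₃ M hN1 hN2 hN3 := rfl

/-- (Ported verbatim from the HodgeCMPerL package; no docstring in the source.) -/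
theorem pohlmannSpan_of_facts₃_eq (M : U.ModelAxioms) (hN1 : U.Fact_cupExterior) (hN2 : U.Fact_cup_hodge)
    (hN3 : U.Fact_pull_H0) :
    pohlmannSpan_of_facts₃' M hN1 hN2 hN3 = pohlmannSpan_of_facts₃ M hN1 hN2 hN3 := rfl

end Universe

end HodgeCM

end
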